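import Mathlib.LinearAlgebra.Matrix.Rank
import Literature.Computability.AlgebraicComplexity.JelisiejewLandsbergPal2023MinimalBorderRank
import Literature.Computability.AlgebraicComplexity.ApproxDecompositionCertificate
import Literature.Computability.AlgebraicComplexity.BorderRankFlattening
import HarnessLib

/-!
# A concise tensor of minimal border rank in `K⁶ ⊗ K⁶ ⊗ K⁶` that is 111-abundant and NOT 111-sharp
# (route `SaturationLadder`, beneath item stmt-MatrixMultiplication-25909 `SubexpSaturation`; cell `decomp-mm`, lens 1, gen 38)

PROVED, 0 sorry; no instances, no notation, no named facts; route-free (imports `Literature` and Mathlib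
only).  Two small definitions (`t6Support`, `t6`, `t6Triples`) name the literal data.

THE TENSOR.  Let `G = K²` with basis `g₀, g₁` and `H = (G ⊗ G)^* = K⁴` with basis `h_{ab}` dual to
`g_a ⊗ g_b`; put `X = G ⊕ H = K⁶` (coordinates `0, 1` for `g₀, g₁` and `2 + 2a + b` for `h_{ab}`) on each
of the three legs, and let `T₆ ∈ X ⊗ X ⊗ X` be the trilinear form
`T₆(g + h, g' + h', g″ + h″) = h(g' ⊗ g″) + h'(g ⊗ g″) + h″(g ⊗ g')`,
i.e. the `{0,1}`-tensor with the twelve support points `(h_{ab}, a, b)`, `(a, h_{ab}, b)`, `(a, b, h_{ab})`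
(`a, b ∈ {0,1}`): three copies of the pairing `K⁴ ⊗ K² ⊗ K² → K` (≅ `⟨2,1,2⟩`) glued along the
two-dimensional corners, a "matrix-weighted little Coppersmith–Winograd tensor".

THE THEOREMS (`F` any field of characteristic `0`; the certificates are integer computations run by
`decide +kernel` through the tree's certificate tools):
* `isConcise3_t6` — `T₆` is concise (the three flattenings have rank `6`: every slice has a private entry);
* `is111Abundant_nine_t6` — the 111-space `𝔞(T₆) = {(P,Q,R) : P ·₁ T₆ = Q ·₂ T₆ = R ·₃ T₆}` contains NINE
  linearly independent triples: the identity and the eight rank-one triples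
  `(E_{a,h_{bc}}, E_{b,h_{ac}}, E_{c,h_{ab}})`, `a,b,c ∈ {0,1}`, each of which contracts `T₆` to the
  elementary tensor `g_a ⊗ g_b ⊗ g_c` (`JLPCert.kerCheck`, `JLPCert.gramRows` + `intTriCheck`).  Hence
  `dim 𝔞(T₆) ≥ 9 > 6 = m`: `T₆` is 111-abundant and NOT 111-sharp (exact linear algebra outside Lean,
  `gen38/abundant_g38.py`, gives `dim 𝔞(T₆) = 9` on the nose, `𝔞(T₆) ≅ K ⊕ V` with `V² = 0`, `dim V = 8`,
  by BOTH the compatible-triple system and JLP's literal triple intersection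
  `(T(A*)⊗A) ∩ (T(B*)⊗B) ∩ (T(C*)⊗C)`; controls `T_{O58}, T_{O56}, T_{O54}` sharp, little `cw₂` not
  abundant);
* `algBorderRank_t6_le` / `algBorderRank_t6` — `bR(T₆) = 6`: MINIMAL border rank.  Upper bound by the
  order-one decomposition with six triads and multiplier `2`
  `∑_{a+b+c even} 2(g_a + ε h_{bc}) ⊗ (g_b + ε h_{ac}) ⊗ (g_c + ε h_{ab}) − f₊^{⊗3} − f₋^{⊗3} = 2ε·T₆ + O(ε²)`,
  `f_± = g₀ ± g₁` (the four parity points `(a,b,c)`, `a+b+c` even, form a Latin square, so the `ε¹`-term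
  is exactly `2 T₆` and the `ε⁰`-term is twice the parity tensor `∑_{a+b+c even} g_a g_b g_c = ½(f₊³ + f₋³)`)
  — `ApproxCert.check` with `D = 2`, valid wherever `2` is a unit; lower bound `6` by conciseness
  (`card_le_algBorderRank_of_linearIndependent`);
* `exists_concise_minimalBorderRank_strictlyAbundant` — the headline over `ℂ`.

WHAT IT ANSWERS.  Jelisiejew–Landsberg–Pal, *Concise tensors of minimal border rank*, Math. Ann. (2023),
arXiv:2205.05713, §1.4.1 (p. 7): "We do not know any example of a concise tensor `T` which is
111-abundant and is not 111-sharp … such a tensor would have to be `1`-degenerate, with `T(A*), T(B*), T(C*)`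
of bounded (matrix) rank at most `m − 2`, and … it would have to occur in dimension greater than `5`.  Does
there exist such an example?"  `T₆` is such an example in the first admissible dimension `m = 6`, with
every slice of rank `≤ 4 = m − 2` on each leg (block form `[[*, N], [N', 0]]` with `N, N'` of rank `≤ 2`),
and it is moreover of minimal border rank, so that at `m = 6` the 111-algebra of a minimal-border-rank
tensor need not be `m`-dimensional (for `m ≤ 5` it always is: JLP Thm. 1.5 / Jagiełła–Jelisiejew 2024,
§2.6, where 111-sharpness of minimal-border-rank tensors is the standing assumption of the degeneration
analysis).  In module language (JLP Thm. 5.5) `T₆ = T_φ` for the null algebra `𝒜 = K ⊕ V`, `V = (G⊗G⊗G)^*`,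
`dim 𝒜 = 9`, acting faithfully on the three `6`-dimensional modules `G_i ⊕ H_i` by `S · g_i = S(g_i, ·, ·)`.
The family `G = K^g`, `H = (G⊗G)^*`, `m = g² + g` has `dim 𝔞 ≥ g³ + 1` (`g = 3`: `m = 12`, `28` independent
triples, checked exactly outside Lean); only `g = 2` is certified here.

HONEST FRAMING / RELEVANCE TO THE ROUTE.  This is a structure result about BASES of the laser method
(minimal-border-rank tensors), found while testing the lineage's rank-sum law (memo
`decomp-mm-lens-1/gen37`–`gen38`: the unique-usage map `U1` of item 25909 is analysed through the
111-algebra / module structure of 111-abundant bases, JLP Thm. 5.5); `T₆` is the first base in that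
analysis with slice corank `2` on every leg, and it satisfies the rank-sum law (memo gen38 §2).  It says
NOTHING about `ω`, closes no item, and does not touch the route's cut; it is banked beneath
stmt-MatrixMultiplication-25909 as context for the base census.  Search record (gen38 memo §4): corpus
(`lit search`, `lit vsearch`), the 21 papers citing JLP23 in the local citation graph (incl. arXiv:2409.06025,
2307.08777, 2512.05215, 2601.01648, 2604.19872) and galaxy (`111-sharp|111-abundant|strictly abundant`,
all stars) show no example in print as of this file.

References: [JelisiejewLandsbergPal2023] (§1.1, §1.4.1 p. 7, Prop. 1.1/Thm. 1.5, Thm. 5.5),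
[BuczynskaBuczynski2021] (Thm. 1.2), [Blaser2013] (Def. 6.1), [BurgisserClausenShokrollahi1997] (§15.4, §15.8).
-/

set_option linter.dupNamespace false

noncomputable section

open scoped BigOperators Matrix

namespace Summit.MatrixMultiplication.MatrixMultiplication.Theorems.SaturationLadderStrictlyAbundantBase

open Literature.Computability.AlgebraicComplexity Literature.LinearAlgebra.Matrix

universe u

/-! ## §1 The tensor -/

/-- The support of `T₆`: the twelve points `(h_{ab}, a, b)`, `(a, h_{ab}, b)`, `(a, b, h_{ab})`, `a, b ∈ {0,1}`,
with `h_{ab} = 2 + 2a + b`. [cite: JelisiejewLandsbergPal2023, §1.4.1 (p. 7)] -/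
def t6Support : List (ℕ × ℕ × ℕ) :=
  [(2, 0, 0), (0, 2, 0), (0, 0, 2), (3, 0, 1), (0, 3, 1), (0, 1, 3), (4, 1, 0), (1, 4, 0), (1, 0, 4),
    (5, 1, 1), (1, 5, 1), (1, 1, 5)]

/-- `T₆ ∈ ℤ⁶ ⊗ ℤ⁶ ⊗ ℤ⁶`, the `{0,1}`-tensor on `t6Support` (read in any field by `Int.cast`).
[cite: JelisiejewLandsbergPal2023, §1.4.1 (p. 7)] -/
def t6 : Fin 6 → Fin 6 → Fin 6 → ℤ :=
  supportTensor 6 t6Support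

/-- The nine listed triples `(P, Q, R)` of the 111-space, flattened (`P`-block `6i+j`, `Q`-block `36+6i+j`,
`R`-block `72+6i+j`, trailing zeros dropped): the identity triple and the eight rank-one triples
`(E_{a,h_{bc}}, E_{b,h_{ac}}, E_{c,h_{ab}})`, `(a,b,c) ∈ {0,1}³` in lexicographic order.
[cite: JelisiejewLandsbergPal2023, Def. 1.9] -/
def t6Triples : List (List ℤ) :=
  [[1, 0, 0, 0, 0, 0, 0, 1, 0, 0, 0, 0, 0, 0, 1, 0, 0, 0, 0, 0, 0, 1, 0, 0, 0, 0, 0, 0, 1, 0, 0, 0, 0, 0, 0, 1,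
    1, 0, 0, 0, 0, 0, 0, 1, 0, 0, 0, 0, 0, 0, 1, 0, 0, 0, 0, 0, 0, 1, 0, 0, 0, 0, 0, 0, 1, 0, 0, 0, 0, 0, 0, 1,
    1, 0, 0, 0, 0, 0, 0, 1, 0, 0, 0, 0, 0, 0, 1, 0, 0, 0, 0, 0, 0, 1, 0, 0, 0, 0, 0, 0, 1, 0, 0, 0, 0, 0, 0, 1],
   -- (a,b,c) = (0,0,0): P = E_{0,2}, Q = E_{0,2}, R = E_{0,2}
   List.replicate 2 0 ++ [1] ++ List.replicate 35 0 ++ [1] ++ List.replicate 35 0 ++ [1],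
   -- (0,0,1): P = E_{0,3}, Q = E_{0,3}, R = E_{1,2}
   List.replicate 3 0 ++ [1] ++ List.replicate 35 0 ++ [1] ++ List.replicate 40 0 ++ [1],
   -- (0,1,0): P = E_{0,4}, Q = E_{1,2}, R = E_{0,3}
   List.replicate 4 0 ++ [1] ++ List.replicate 39 0 ++ [1] ++ List.replicate 30 0 ++ [1],
   -- (0,1,1): P = E_{0,5}, Q = E_{1,3}, R = E_{1,3}
   List.replicate 5 0 ++ [1] ++ List.replicate 39 0 ++ [1] ++ List.replicate 35 0 ++ [1],
   -- (1,0,0): P = E_{1,2}, Q = E_{0,4}, R = E_{0,4}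
   List.replicate 8 0 ++ [1] ++ List.replicate 31 0 ++ [1] ++ List.replicate 35 0 ++ [1],
   -- (1,0,1): P = E_{1,3}, Q = E_{0,5}, R = E_{1,4}
   List.replicate 9 0 ++ [1] ++ List.replicate 31 0 ++ [1] ++ List.replicate 40 0 ++ [1],
   -- (1,1,0): P = E_{1,4}, Q = E_{1,4}, R = E_{0,5}
   List.replicate 10 0 ++ [1] ++ List.replicate 35 0 ++ [1] ++ List.replicate 30 0 ++ [1],
   -- (1,1,1): P = E_{1,5}, Q = E_{1,5}, R = E_{1,5}
   List.replicate 11 0 ++ [1] ++ List.replicate 35 0 ++ [1] ++ List.replicate 35 0 ++ [1]]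

/-! ## §2 The integer certificates (`decide +kernel`) -/

/-- Conciseness certificate, leg `A`: slice `z` has the private entry at column code `piv[z]`
(`h_{ab} ↦ (a,b)`, `g_a ↦ (0, h_{a0})`). [folklore] -/
theorem t6_slabCheck₁ :
    intTriCheck 6 (fun r c => slab₁ t6 (finCode 6 r) (slabColCode 6 c))
      [[(0, 1)], [(1, 1)], [(2, 1)], [(3, 1)], [(4, 1)], [(5, 1)]] [2, 4, 0, 1, 6, 7] = true := by
  decide +kernel

/-- Conciseness certificate, leg `B`. [folklore] -/
theorem t6_slabCheck₂ :
    intTriCheck 6 (fun r c => slab₁ (rotate t6) (finCode 6 r) (slabColCode 6 c))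
      [[(0, 1)], [(1, 1)], [(2, 1)], [(3, 1)], [(4, 1)], [(5, 1)]] [2, 4, 0, 6, 1, 7] = true := by
  decide +kernel

/-- Conciseness certificate, leg `C`. [folklore] -/
theorem t6_slabCheck₃ :
    intTriCheck 6 (fun r c => slab₁ (rotate (rotate t6)) (finCode 6 r) (slabColCode 6 c))
      [[(0, 1)], [(1, 1)], [(2, 1)], [(3, 1)], [(4, 1)], [(5, 1)]] [2, 3, 0, 1, 6, 7] = true := by
  decide +kernel

/-- The nine listed triples lie in the 111-space of `T₆`: `P ·₁ T₆ = Q ·₂ T₆ = R ·₃ T₆` entry by entry over `ℤ`.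
[cite: JelisiejewLandsbergPal2023, Def. 1.9] -/
theorem t6_kerCheck : JLPCert.kerCheck 6 9 t6 t6Triples = true := by
  decide +kernel

/-- The nine listed triples are linearly independent: each has a private coordinate (pivot codes
`0, 2, 3, 4, 5, 8, 9, 10, 11` of the `P`-block). [folklore] -/
theorem t6_gramCheck :
    intTriCheck 9 (fun r c => JLPCert.gramRows 6 9 t6Triples (finCode 9 r) (colCode111 6 c))
      [[(0, 1)], [(1, 1)], [(2, 1)], [(3, 1)], [(4, 1)], [(5, 1)], [(6, 1)], [(7, 1)], [(8, 1)]]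
      [0, 2, 3, 4, 5, 8, 9, 10, 11] = true := by
  decide +kernel

/-- **The border-rank certificate**: the order-one decomposition with SIX triads and multiplier `D = 2`,
`∑_{(a,b,c) ∈ {(000),(011),(101),(110)}} 2(g_a + ε h_{bc}) ⊗ (g_b + ε h_{ac}) ⊗ (g_c + ε h_{ab})
 − f₊ ⊗ f₊ ⊗ f₊ − f₋ ⊗ f₋ ⊗ f₋ = ε · (2 T₆) + O(ε²)`, `f_± = g₀ ± g₁`. [cite: Blaser2013, Def. 6.1] -/
theorem t6_borderCheck :
    ApproxCert.check 6 6 6 6 1 2 t6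
      ![![[2], [], [0, 2], [], [], []], ![[2], [], [], [], [], [0, 2]], ![[], [2], [], [0, 2], [], []],
        ![[], [2], [], [], [0, 2], []], ![[-1], [-1], [], [], [], []], ![[-1], [1], [], [], [], []]]
      ![![[1], [], [0, 1], [], [], []], ![[], [1], [], [0, 1], [], []], ![[1], [], [], [], [], [0, 1]],
        ![[], [1], [], [], [0, 1], []], ![[1], [1], [], [], [], []], ![[1], [-1], [], [], [], []]]
      ![![[1], [], [0, 1], [], [], []], ![[], [1], [], [0, 1], [], []], ![[], [1], [], [], [0, 1], []],
        ![[1], [], [], [], [], [0, 1]], ![[1], [1], [], [], [], []], ![[1], [-1], [], [], [], []]] = true := by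
  decide +kernel

/-! ## §3 The theorems -/

section Field

variable (F : Type u) [Field F]

/-- **`T₆` is concise** (all three flattenings injective), over every field of characteristic `0`.
[cite: JelisiejewLandsbergPal2023, §1.1 (A-, B-, C-concise)] -/
theorem isConcise3_t6 [CharZero F] : IsConcise3 (fun a b c => (t6 a b c : F)) :=
  ⟨JLPCert.linearIndependent_slices_of_intTriCheck t6 t6_slabCheck₁,
    JLPCert.linearIndependent_slices_of_intTriCheck (rotate t6) t6_slabCheck₂,
    JLPCert.linearIndependent_slices_of_intTriCheck (rotate (rotate t6)) t6_slabCheck₃⟩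

/-- **Nine independent triples in the 111-space of `T₆`** (`dim 𝔞(T₆) ≥ 9 > 6`): `T₆` is 111-abundant and
not 111-sharp — an answer to Jelisiejew–Landsberg–Pal 2023, Question §1.4.1, over every field of
characteristic `0`. [cite: JelisiejewLandsbergPal2023, §1.4.1 (p. 7); Def. 1.9] -/
theorem is111Abundant_nine_t6 [CharZero F] : Is111Abundant 9 (fun a b c => (t6 a b c : F)) := by
  refine ⟨fun k j => ((JLPCert.gramRows 6 9 t6Triples) k j : F), ?_, fun k => ?_⟩
  · have hr := le_rank_of_intTriCheck (F := F) (JLPCert.gramRows 6 9 t6Triples) (finCode 9) (colCode111 6)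
      t6_gramCheck
    exact JLPCert.linearIndependent_rows_of_card_le_rank
      ((JLPCert.gramRows 6 9 t6Triples).map (Int.cast : ℤ → F)) (by rw [Fintype.card_fin]; exact hr)
  · have hK := t6_kerCheck
    unfold JLPCert.kerCheck at hK
    rw [List.all_eq_true] at hK
    exact JLPCert.lin111_vecOfList_eq_zero (hK k.val (List.mem_range.2 k.isLt))

/-- Monotonicity of the kernel form of 111-abundance in the count. [folklore] -/
theorem is111Abundant_mono {Z X Y : Type*} [Fintype Z] [Fintype X] [Fintype Y] {m m' : ℕ} (h : m' ≤ m)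
    {t : Z → X → Y → F} (ht : Is111Abundant m t) : Is111Abundant m' t := by
  obtain ⟨g, hg, hker⟩ := ht
  exact ⟨fun i => g (Fin.castLE h i), hg.comp _ (Fin.castLE_injective h), fun i => hker _⟩

/-- `T₆` is 111-abundant in JLP's sense (`dim 𝔞 ≥ m = 6`) and strictly so (`≥ m + 1`).
[cite: JelisiejewLandsbergPal2023, §1.1 (111-abundance), §1.4.1] -/
theorem is111Abundant_succ_t6 [CharZero F] : Is111Abundant (6 + 1) (fun a b c => (t6 a b c : F)) :=
  is111Abundant_mono F (by norm_num) (is111Abundant_nine_t6 F)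

/-- **`bR(T₆) ≤ 6`** over every commutative ring in which `2` is a unit (the six-triad order-one
decomposition `t6_borderCheck`). [cite: Blaser2013, Def. 6.1] -/
theorem algBorderRank_t6_le_of_isUnit (K : Type u) [CommRing K] (h2 : IsUnit (2 : K)) :
    algBorderRank (fun a b c => (t6 a b c : K)) ≤ 6 :=
  ApproxCert.algBorderRank_le_of_check K t6_borderCheck (by simpa using h2)

/-- **`bR(T₆) ≤ 6`** over every field of characteristic `0`. [cite: Blaser2013, Def. 6.1] -/
theorem algBorderRank_t6_le [CharZero F] : algBorderRank (fun a b c => (t6 a b c : F)) ≤ 6 :=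
  algBorderRank_t6_le_of_isUnit F (isUnit_iff_ne_zero.mpr two_ne_zero)

/-- **`6 ≤ bR(T₆)`**: conciseness of the first leg (flattening lower bound), every field of characteristic `0`.
[cite: Blaser2013, Lemma 7.1(2) (proof)] -/
theorem le_algBorderRank_t6 [CharZero F] : 6 ≤ algBorderRank (fun a b c => (t6 a b c : F)) := by
  have h := card_le_algBorderRank_of_linearIndependent (fun a b c => (t6 a b c : F)) (isConcise3_t6 F).1
  rwa [Fintype.card_fin] at h

/-- **`bR(T₆) = 6`: `T₆` has MINIMAL border rank**, every field of characteristic `0`.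
[cite: JelisiejewLandsbergPal2023, §1.4.1 (p. 7)] -/
theorem algBorderRank_t6 [CharZero F] : algBorderRank (fun a b c => (t6 a b c : F)) = 6 :=
  le_antisymm (algBorderRank_t6_le F) (le_algBorderRank_t6 F)

end Field

/-- **Answer to JLP23 Question 1.4.1, with minimal border rank.**  There is a concise tensor in
`ℂ⁶ ⊗ ℂ⁶ ⊗ ℂ⁶` of (minimal) border rank `6` whose 111-space contains `9 > 6` linearly independent triples
(111-abundant, not 111-sharp). [cite: JelisiejewLandsbergPal2023, §1.4.1 (p. 7)] -/
theorem exists_concise_minimalBorderRank_strictlyAbundant :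
    ∃ t : Fin 6 → Fin 6 → Fin 6 → ℂ, IsConcise3 t ∧ algBorderRank t = 6 ∧ Is111Abundant 9 t :=
  ⟨fun a b c => (t6 a b c : ℂ), isConcise3_t6 ℂ, algBorderRank_t6 ℂ, is111Abundant_nine_t6 ℂ⟩

/-- The same in JLP's wording: concise, of format `m × m × m` with `m = 6`, 111-abundant with at least
`m + 1` independent triples (strict inequality in (111-abundance)), and of border rank `m`.
[cite: JelisiejewLandsbergPal2023, §1.4.1 (p. 7)] -/
theorem exists_concise_abundant_not_sharp :
    ∃ (m : ℕ) (t : Fin m → Fin m → Fin m → ℂ), IsConcise3 t ∧ algBorderRank t = m ∧ Is111Abundant (m + 1) t :=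
  ⟨6, fun a b c => (t6 a b c : ℂ), isConcise3_t6 ℂ, algBorderRank_t6 ℂ, is111Abundant_succ_t6 ℂ⟩

end Summit.MatrixMultiplication.MatrixMultiplication.Theorems.SaturationLadderStrictlyAbundantBase
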